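import Summits.QuantumFields.BalabanUV.T4Continuum.Support.ShiftedZerothOrder
import Summits.QuantumFields.BalabanUV.T4Continuum.Support.CovariantDivergencePlanting

/-!
# T⁴ programme, spine node NE2 (U1a) — THE COMPONENT-TRANSPOSITION CARRIER `Π_{νμ} = ι_ν·ι_μᴴ` for the shifted zeroth-order
# catalogue: OFF-DIAGONAL blocks (in the 1-form component index) of «bounded colour field × lattice shift» shape

NE2 formalisation swarm `t4-ne2-formalise-*`, leaf prover 10 (gen 2), SUPPLIER for the owner's row **B2.w** («Hodge form»; scope-note delta
Δ5 of `t4/b2b-balaban-t4-ne2-p1/SCOPE-ROOTB-vs-NE2PLUS.md`; offered CLAIMS.log l.7042, the owner may refuse).  The owner's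
`Support/LatticeWeitzenbock.weitzenbock` gives `½curlᴴcurl + divᴴdiv = rough + comm` with `comm` the BLOCK operator whose `(ν, μ)` block is
`[∇_ν, ∇_μᴴ]`, and `comm_affine` shows that for covariant lattice differences each block is `|c|²·(bounded colour field)·S_μᴴS_ν` on 0-forms ⊗
colour.  On the tree's colour-lifted 1-form spaces `idx L M k × o = (Tor × Fin d) × o`, however, BOTH factors of the catalogue shape of
`Support/ShiftedZerothOrder` — `BlockMultiplication.siteMul z` (block-diagonal in `idx`) and the lifted shifts `S ⊗ₖ 1`
(`B5Prop11Plancherel.shiftM` translates every component alike) — are DIAGONAL in the component index `κ ∈ Fin d`, so `siteMul z * T` carries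
only `ν = μ` blocks.  The missing carrier is the component transposition `Π_{νμ}`, `(Π_{νμ}A)_κ(x) = [κ = ν]·A_μ(x)`:
 * §1 `swapT Nf ν μ := injM ν * (injM μ)ᴴ` (leaf-10's component injections of `Support/GaugeTermDecomposition`), a contraction
   (`opNorm_swapT_le`), commuting with the 1-form translations (`shiftM_mul_swapT`) and intertwining King's pairings EXACTLY:
   **`swapT_mul_JK`** `Π′_{νμ}·J = J·Π_{νμ}` (from `CovariantDivergencePlanting.JK_mul_injM` / `JK0_mul_injMH`: King's 1-form planting is the
   0-form planting on every component);
 * §2 along the tower: `cSwap L M ν μ k := swapT ⊗ₖ 1`, `cSwap_mul_Jc`; **`shiftLaws_mul_left`**: `ShiftLaws` (the hypothesis SHAPE of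
   `ShiftedZerothOrder`) is STABLE under left multiplication by any contraction family intertwining `Jc` exactly (same constant `ct`);
   hence **`shiftLaws_swap_mul`**, `shiftLaws_swap` (ct = 0), and **`perturbationLaws_siteMul_swap_mul`**:
   `BoundedBackgroundM z α β → ShiftLaws T ct → PerturbationLaws (Δ_a⊗1) (k ↦ siteMul (z k) * (Π_{νμ} * T k)) (J⊗1) (αCst) (Cst(α·ct + βCst)L^{−k})`,
   with the instances `perturbationLaws_swap_fwd/bwd` (`T = S_λ ⊗ 1`, `S_λᴴ ⊗ 1`; the mixed `S_μᴴS_ν ⊗ 1` of the owner's v1.1 plugs in BY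
   NAME the same way once it lands).
So the reindexed commutator operator `Σ_{ν,μ} Π_{νμ}·siteMul(z_{νμ})·(S_μᴴS_ν ⊗ 1)` is a finite sum of catalogue terms
(`PerturbationAlgebra.perturbationLaws_add` / `KroneckerUnits.perturbationLaws_finsetSum`).

HONEST FRAMING (T4-DAG p. 1).  [folklore]-level bookkeeping OURS at MODEL LEVEL (colour fields, shifts, transporters are DATA); it does NOT
assert the Weitzenböck identity for Bałaban's `Δ(U)` nor the dictionary B0 (trigger c5), constructs no transporter, and changes nothing in the
countdown; finite torus, linear layer, operator norm; NOT [B9] (3.10)/(3.23)–(3.26) as printed; NE2 NOT PROVED; NOT infinite volume, NOT a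
mass gap, NOT Clay, NOT summit progress; spine 0/9 unchanged.  HONEST DEPENDENCY: continuum YM on T⁴ ⇐ BetaPertH ∧ nine spine estimates
(0/9 proved); BetaPertH ⇐ (D1) ∧ (D4) ∧ CAP+tail; G-an2-4 gates asym, D1 and NE2/3/4.  ABSOLUTE RULE kept: nothing printed is a
hypothesis; no `def … : Prop` fact; no `sorry`.
-/

noncomputable section

open scoped BigOperators ComplexConjugate Matrix Matrix.Norms.L2Operator Kronecker

namespace Summit.QuantumFields.BalabanUV.T4Continuum.ComponentSwapShift

open Literature.MathematicalPhysics.QuantumFieldTheory.Balaban1983to89.B5Prop11Plancherel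
open Literature.MathematicalPhysics.QuantumFieldTheory.Balaban1983to89.B5G183RateUnitTower (lev lev_neZero)
open Summit.QuantumFields.BalabanUV.T4Continuum
open Summit.QuantumFields.BalabanUV.T4Continuum.BalabanAveragedTowerUnit (idx)
open Summit.QuantumFields.BalabanUV.T4Continuum.BackgroundResolventTower
open Summit.QuantumFields.BalabanUV.T4Continuum.KingPairingPlantedLaw
open Summit.QuantumFields.BalabanUV.T4Continuum.KroneckerLift
open Summit.QuantumFields.BalabanUV.T4Continuum.BlockMultiplication
open Summit.QuantumFields.BalabanUV.T4Continuum.ColourCovariantLaplacian (BoundedBackgroundM)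
open Summit.QuantumFields.BalabanUV.T4Continuum.TransportedSiteAveraging (Dc Jc)
open Summit.QuantumFields.BalabanUV.T4Continuum.GaugeTermDecomposition (injM conjTranspose_injM_mul_injM opNorm_injM_le
  opNorm_injM_conjTranspose_le shiftM_mul_injM injMH_mul_shiftM)
open Summit.QuantumFields.BalabanUV.T4Continuum.CovariantDivergencePlanting (JK_mul_injM JK0_mul_injMH)
open Summit.QuantumFields.BalabanUV.T4Continuum.ShiftedZerothOrder (ShiftLaws perturbationLaws_siteMul_mul Sfwd Sbwd shiftLaws_fwd
  shiftLaws_bwd shiftLaws_one)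

variable {d : ℕ}

/-! ## §1 The component transposition on one-forms -/

section OneLevel

variable (Nf : Fin d → ℕ) [hNf : ∀ μ, NeZero (Nf μ)]

/-- **THE COMPONENT TRANSPOSITION** `Π_{νμ} = ι_ν·ι_μᴴ` on lattice 1-forms: `(Π_{νμ}A)_κ(x) = [κ = ν]·A_μ(x)` (moves component `μ` into
slot `ν`, kills the rest). [folklore] -/
def swapT (ν μ : Fin d) : Matrix (Tor Nf × Fin d) (Tor Nf × Fin d) ℂ := injM Nf ν * (injM Nf μ)ᴴ

/-- entries: `Π_{νμ} (x,κ) (y,λ) = [κ = ν]·[(y,λ) = (x,μ)]`. [folklore] -/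
theorem swapT_apply (ν μ : Fin d) (i j : Tor Nf × Fin d) :
    swapT Nf ν μ i j = if i.2 = ν ∧ j = (i.1, μ) then 1 else 0 := by
  rw [swapT, Matrix.mul_apply, Finset.sum_eq_single i.1]
  · simp only [injM, Matrix.conjTranspose_apply]
    by_cases h1 : i.2 = ν
    · have hi : i = (i.1, ν) := Prod.ext rfl h1
      rw [← hi, if_pos rfl, one_mul]
      by_cases h2 : j = (i.1, μ)
      · rw [h2, if_pos rfl, star_one, if_pos ⟨h1, rfl⟩]
      · rw [if_neg h2, star_zero, if_neg fun h => h2 h.2]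
    · have hi : i ≠ (i.1, ν) := fun h => h1 (by rw [h])
      rw [if_neg hi, zero_mul, if_neg fun h => h1 h.1]
  · intro y _ hy
    simp only [injM, Matrix.conjTranspose_apply]
    have hi : i ≠ (y, ν) := fun h => hy (by rw [h])
    rw [if_neg hi, zero_mul]
  · intro h; exact absurd (Finset.mem_univ _) h

/-- `Π_{μμ}` summed over `μ` is the identity (`Σ_μ ι_μι_μᴴ = 1`). [folklore] -/
theorem sum_swapT_diag : ∑ μ, swapT Nf μ μ = 1 := by
  ext i j
  rw [Matrix.sum_apply, Finset.sum_eq_single i.2]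
  · rw [swapT_apply, Matrix.one_apply]
    by_cases h : i = j
    · subst h; rw [if_pos ⟨rfl, Prod.ext rfl rfl⟩, if_pos rfl]
    · rw [if_neg h, if_neg]
      rintro ⟨-, hj⟩
      exact h (by rw [hj])
  · intro μ _ hμ; rw [swapT_apply, if_neg fun h' => hμ h'.1.symm]
  · intro h; exact absurd (Finset.mem_univ _) h

/-- `Π_{νμ}ᴴ = Π_{μν}`. [folklore] -/
theorem swapT_conjTranspose (ν μ : Fin d) : (swapT Nf ν μ)ᴴ = swapT Nf μ ν := by
  rw [swapT, swapT, Matrix.conjTranspose_mul, Matrix.conjTranspose_conjTranspose]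

/-- `Π_{νμ}·Π_{μλ} = Π_{νλ}` (`ι_μᴴι_μ = 1`). [folklore] -/
theorem swapT_mul_swapT (ν μ lam : Fin d) : swapT Nf ν μ * swapT Nf μ lam = swapT Nf ν lam := by
  rw [swapT, swapT, swapT, Matrix.mul_assoc, ← Matrix.mul_assoc (injM Nf μ)ᴴ, conjTranspose_injM_mul_injM, Matrix.one_mul]

/-- **`‖Π_{νμ}‖ ≤ 1`** (a partial isometry). [folklore] -/
theorem opNorm_swapT_le (ν μ : Fin d) : ‖swapT Nf ν μ‖ ≤ 1 :=
  (Matrix.l2_opNorm_mul _ _).trans ((mul_le_mul (opNorm_injM_le Nf ν) (opNorm_injM_conjTranspose_le Nf μ) (norm_nonneg _)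
    zero_le_one).trans (le_of_eq (mul_one _)))

/-- **1-form translations commute with `Π_{νμ}`** (they act alike on every component). [folklore] -/
theorem shiftM_mul_swapT (lam ν μ : Fin d) : shiftM Nf lam * swapT Nf ν μ = swapT Nf ν μ * shiftM Nf lam := by
  rw [swapT, ← Matrix.mul_assoc, shiftM_mul_injM, Matrix.mul_assoc, Matrix.mul_assoc, injMH_mul_shiftM]

/-- … and so do their adjoints. [folklore] -/
theorem shiftM_conjTranspose_mul_swapT (lam ν μ : Fin d) :
    (shiftM Nf lam)ᴴ * swapT Nf ν μ = swapT Nf ν μ * (shiftM Nf lam)ᴴ := by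
  have h := congrArg Matrix.conjTranspose (shiftM_mul_swapT Nf lam μ ν)
  rw [Matrix.conjTranspose_mul, Matrix.conjTranspose_mul, swapT_conjTranspose] at h
  exact h.symm

end OneLevel

section TwoLevel

variable (N R : ℕ) [NeZero N] [NeZero R] (M : Fin d → ℕ) [hM : ∀ μ, NeZero (M μ)]

/-- **`Π′_{νμ}·J = J·Π_{νμ}`** — King's 1-form pairing intertwines the component transpositions EXACTLY (it is the 0-form pairing on every
component: `J·ι_μ = ι′_μ·J⁰`, `J⁰·ι_μᴴ = ι′_μᴴ·J`). [cite: King1986, (2.10) p.653 (shape of the pairing)] [folklore] -/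
theorem swapT_mul_JK (ν μ : Fin d) : swapT (fine (R * N) M) ν μ * JK N R M = JK N R M * swapT (fine N M) ν μ := by
  rw [swapT, swapT, Matrix.mul_assoc, ← JK0_mul_injMH, ← Matrix.mul_assoc, ← JK_mul_injM, Matrix.mul_assoc]

end TwoLevel

/-! ## §2 Along the tower: `ShiftLaws` is stable under exactly-intertwining contractions; the swap instances -/

section Tower

variable (L : ℕ) [NeZero L] (M : Fin d → ℕ) [hM : ∀ μ, NeZero (M μ)] (a : ℝ) (ha : 0 < a) {o : Type*} [Fintype o] [DecidableEq o]

/-- the colour-lifted component transposition at level `k`. [folklore] -/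
def cSwap (ν μ : Fin d) (k : ℕ) : Matrix (idx L M k × o) (idx L M k × o) ℂ := swapT (fine (lev L k) M) ν μ ⊗ₖ (1 : Matrix o o ℂ)

/-- `‖cSwap‖ ≤ 1`. [folklore] -/
theorem opNorm_cSwap_le (ν μ : Fin d) (k : ℕ) : ‖cSwap L M (o := o) ν μ k‖ ≤ 1 :=
  opNorm_kron_le_of_le o (opNorm_swapT_le _ ν μ)

/-- `cSwap (k+1) · Jc k = Jc k · cSwap k`. [folklore] -/
theorem cSwap_mul_Jc (ν μ : Fin d) (k : ℕ) :
    cSwap L M (o := o) ν μ (k + 1) * Jc L M (o := o) k = Jc L M (o := o) k * cSwap L M (o := o) ν μ k := by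
  rw [cSwap, cSwap, Jc, JpcT_eq_JK, ← kron_mul, ← kron_mul]
  exact congrArg (fun X => X ⊗ₖ (1 : Matrix o o ℂ)) (swapT_mul_JK (lev L k) L M ν μ)

/-- the lifted forward shifts commute with `cSwap`. [folklore] -/
theorem Sfwd_mul_cSwap (lam ν μ : Fin d) (k : ℕ) :
    Sfwd L M (o := o) lam k * cSwap L M (o := o) ν μ k = cSwap L M (o := o) ν μ k * Sfwd L M (o := o) lam k := by
  rw [Sfwd, cSwap, ← kron_mul, ← kron_mul, shiftM_mul_swapT]

/-- the lifted backward shifts commute with `cSwap`. [folklore] -/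
theorem Sbwd_mul_cSwap (lam ν μ : Fin d) (k : ℕ) :
    Sbwd L M (o := o) lam k * cSwap L M (o := o) ν μ k = cSwap L M (o := o) ν μ k * Sbwd L M (o := o) lam k := by
  rw [Sbwd, cSwap, ← kron_mul, ← kron_mul, shiftM_conjTranspose_mul_swapT]

/-- **`ShiftLaws` IS STABLE UNDER LEFT MULTIPLICATION BY AN EXACTLY-INTERTWINING CONTRACTION FAMILY** (same constant):
`‖E_k‖ ≤ 1`, `E_{k+1}·J_k = J_k·E_k` and `ShiftLaws T ct` give `ShiftLaws (k ↦ E_k·T_k) ct`, because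
`E′T′J − JET = E′(T′J − JT)`. [folklore] -/
theorem shiftLaws_mul_left {E T : (k : ℕ) → Matrix (idx L M k × o) (idx L M k × o) ℂ} {ct : ℝ} (hE : ∀ k, ‖E k‖ ≤ 1)
    (hEJ : ∀ k, E (k + 1) * Jc L M (o := o) k = Jc L M (o := o) k * E k) (hT : ShiftLaws L M a ha T ct) :
    ShiftLaws L M a ha (fun k => E k * T k) ct where
  nonneg := hT.nonneg
  opNorm_le := fun k => (Matrix.l2_opNorm_mul _ _).trans ((mul_le_mul (hE k) (hT.opNorm_le k) (norm_nonneg _) zero_le_one).trans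
    (le_of_eq (mul_one _)))
  intertwine_le := fun k => by
    have e : (E (k + 1) * T (k + 1) * Jc L M (o := o) k - Jc L M (o := o) k * (E k * T k)) * (Dc L M a ha (o := o) k)⁻¹
        = E (k + 1) * ((T (k + 1) * Jc L M (o := o) k - Jc L M (o := o) k * T k) * (Dc L M a ha (o := o) k)⁻¹) := by
      rw [← Matrix.mul_assoc (Jc L M k), ← hEJ k]
      simp only [Matrix.mul_sub, Matrix.sub_mul, Matrix.mul_assoc]
    rw [e]
    exact (Matrix.l2_opNorm_mul _ _).trans ((mul_le_mul (hE (k + 1)) (hT.intertwine_le k) (norm_nonneg _) zero_le_one).trans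
      (le_of_eq (one_mul _)))

/-- **THE SWAPPED SHIFT FAMILIES OBEY `ShiftLaws`** with the same constant. [folklore] -/
theorem shiftLaws_swap_mul (ν μ : Fin d) {T : (k : ℕ) → Matrix (idx L M k × o) (idx L M k × o) ℂ} {ct : ℝ}
    (hT : ShiftLaws L M a ha T ct) : ShiftLaws L M a ha (fun k => cSwap L M (o := o) ν μ k * T k) ct :=
  shiftLaws_mul_left L M a ha (opNorm_cSwap_le L M ν μ) (cSwap_mul_Jc L M ν μ) hT

/-- the bare transposition (`T = 1`): `ShiftLaws (cSwap ν μ) 0`. [folklore] -/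
theorem shiftLaws_swap (ν μ : Fin d) : ShiftLaws L M a ha (cSwap L M (o := o) ν μ) 0 := by
  have h := shiftLaws_swap_mul L M a ha ν μ (shiftLaws_one L M a ha (o := o))
  simp only [Matrix.mul_one] at h
  exact h

/-- **THE SHIFTED ZEROTH-ORDER LAW WITH A COMPONENT TRANSPOSITION**: a bounded, two-level consistent colour field times `Π_{νμ}` times any
shift family obeying `ShiftLaws` satisfies `PerturbationLaws (Δ_a⊗1) (k ↦ siteMul (z k)·(Π_{νμ}·T_k)) (J⊗1) (αCst) (Cst(α·ct + βCst)·L^{−k})`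
(`ShiftedZerothOrder.perturbationLaws_siteMul_mul` on `shiftLaws_swap_mul`). [folklore] -/
theorem perturbationLaws_siteMul_swap_mul {z : (k : ℕ) → idx L M k → Matrix o o ℂ} {α β : ℝ} (hz : BoundedBackgroundM L M z α β)
    (ν μ : Fin d) {T : (k : ℕ) → Matrix (idx L M k × o) (idx L M k × o) ℂ} {ct : ℝ} (hT : ShiftLaws L M a ha T ct) :
    PerturbationLaws (Dc L M a ha) (fun k => siteMul (z k) * (cSwap L M (o := o) ν μ k * T k)) (Jc L M)
      (α * Cst d a) (fun k => Cst d a * (α * ct + β * Cst d a) * ((L : ℝ)⁻¹) ^ k) :=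
  perturbationLaws_siteMul_mul L M a ha hz (shiftLaws_swap_mul L M a ha ν μ hT)

/-- instance: transposition × forward shift, `P_k = siteMul (z k)·Π_{νμ}·(S_λ ⊗ 1)` (`ct = Cst`). [folklore] -/
theorem perturbationLaws_swap_fwd {z : (k : ℕ) → idx L M k → Matrix o o ℂ} {α β : ℝ} (hz : BoundedBackgroundM L M z α β)
    (ν μ lam : Fin d) :
    PerturbationLaws (Dc L M a ha) (fun k => siteMul (z k) * (cSwap L M (o := o) ν μ k * Sfwd L M (o := o) lam k)) (Jc L M)
      (α * Cst d a) (fun k => Cst d a * (α * Cst d a + β * Cst d a) * ((L : ℝ)⁻¹) ^ k) :=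
  perturbationLaws_siteMul_swap_mul L M a ha hz ν μ (shiftLaws_fwd L M a ha lam)

/-- instance: transposition × backward shift, `P_k = siteMul (z k)·Π_{νμ}·(S_λᴴ ⊗ 1)` (`ct = Cst`). [folklore] -/
theorem perturbationLaws_swap_bwd {z : (k : ℕ) → idx L M k → Matrix o o ℂ} {α β : ℝ} (hz : BoundedBackgroundM L M z α β)
    (ν μ lam : Fin d) :
    PerturbationLaws (Dc L M a ha) (fun k => siteMul (z k) * (cSwap L M (o := o) ν μ k * Sbwd L M (o := o) lam k)) (Jc L M)
      (α * Cst d a) (fun k => Cst d a * (α * Cst d a + β * Cst d a) * ((L : ℝ)⁻¹) ^ k) :=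
  perturbationLaws_siteMul_swap_mul L M a ha hz ν μ (shiftLaws_bwd L M a ha lam)

/-- instance: the bare transposition, `P_k = siteMul (z k)·Π_{νμ}` (`ct = 0`: a pure zeroth-order colour coupling between two components).
[folklore] -/
theorem perturbationLaws_siteMul_swap {z : (k : ℕ) → idx L M k → Matrix o o ℂ} {α β : ℝ} (hz : BoundedBackgroundM L M z α β)
    (ν μ : Fin d) :
    PerturbationLaws (Dc L M a ha) (fun k => siteMul (z k) * cSwap L M (o := o) ν μ k) (Jc L M)
      (α * Cst d a) (fun k => Cst d a * β * Cst d a * ((L : ℝ)⁻¹) ^ k) :=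
  PerturbationAlgebra.perturbationLaws_mono (perturbationLaws_siteMul_mul L M a ha hz (shiftLaws_swap L M a ha ν μ)) le_rfl
    fun k => le_of_eq (by ring)

end Tower

end Summit.QuantumFields.BalabanUV.T4Continuum.ComponentSwapShift

end
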